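import Literature.Analysis.FluidPDE.ClassicalLerayProjection
import Literature.Analysis.FluidPDE.DipolePotentialFlow
import Literature.Analysis.FluidPDE.ClassicalSolution

/-!
# The first-order NS-MATCHED PREPARATION GERM of a compactly supported profile

Cell `ns-blowup`, seat `ns-blowup-ecbridge-3` (g2); GROUP C «BRIDGE SUPPORT» of the route
`PalasekTowerBreakdown` (crux `EpisodeBaseG`, item stmt-NavierStokesRegularity-19179, R2 of record:
the item's live content is `HostPreparationD (HostClass.exact S*)` ∧ `FirstEpisodeD (HostClass.exact S*)`
for a NAMED design `S*`). LABEL: E–C typing (KERNEL vocabulary + identities: three definitions with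
bodies, every theorem proved). WHAT THIS IS NOT: not Navier–Stokes evidence — no stage, schedule, host
or tower is constructed here and nothing is asserted about any flow's dynamics; this is the GENERIC
calculus a prescribed level-`0` host uses to arrive at a named profile `U` AT THE READOUT with an
admissibly small force there.

## What and why

A registered level-`0` host of a schedule `S` is an exact classical forced Navier–Stokes flow on
`[0, τ₀]` whose force is FREE before `τ₀` (only smooth, decaying, confined) but PINNED at the readout:
`‖f(τ₀, ·)‖ ≤ c₄ Y₀ ≤ c₁ Y₀` (`Schedule.push_small` on the closed window `[τ₀, τ₁]`). A prescribed flow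
`u(t) = α(t) U` reaching a named profile `U` at `τ₀` has force `= its own NS residual`, which at `τ₀`
is `α'(τ₀) U + (U·∇)U − νΔU + ∇p` — of size `≍ Y₀²/ℓ + νY₀/ℓ²` for a profile of speed `Y₀` and
scale `ℓ`, far above `c₁Y₀` unless the profile is quasi-static (`ℓ` huge: the Host series of this seat,
p418168 … p428335) or exact (Beltrami). The way out for a GENERAL profile is to MATCH THE GERM: run the
prescribed flow through `U` along the true NS acceleration of `U`,

  `germ t = α(t) • U + β(t) • V`,   `V := P (νΔU − (U·∇)U)`   (`P` = the tree's classical Leray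
  projection `classicalLerayProj`, `P W = W − ∇π[W]`, `π[W] = Δ⁻¹ div W` = `divPotential W`),

with `α(τ₀) = 1`, `α'(τ₀) = 0`, `β(τ₀) = 0`, `β'(τ₀) = 1`, and the pressure

  `germPres t = β'(t) π − β(t)² |∇π|²/2`,   `π := π[νΔU − (U·∇)U]`.

Then (this file): the NS residual `germResid` of `(germ, germPres)` — DEFINED as
`∂ₜ germ + (germ·∇)germ − νΔ germ + ∇ germPres`, so that `(germ, germPres)` is by construction an
exact classical solution forced by `germResid` (`isClassicalNSSolutionOn_germ`) —

* VANISHES IDENTICALLY OUTSIDE `tsupport U` AT ALL TIMES (`germResid_eq_zero_of_notMem_tsupport`): off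
  the profile's support `germ = −β ∇π` is a time-modulated POTENTIAL flow with `π` harmonic there, and
  Bernoulli (`convect_gradient_self`) absorbs everything into the pressure — so the force is CONFINED to
  the profile's support although `germ` itself has the algebraic tail of `∇π`;
* VANISHES EVERYWHERE AT `τ₀` (`germResid_eq_zero_of_matched`): `V + (U·∇)U − νΔU + ∇π = 0` by the
  Helmholtz decomposition (`classicalLerayProj_apply`);
* so a schedule force `fade • germResid` is `≤ c₄ Y₀` on `[τ₀, τ₁]` for ANY prescribed `c₄ > 0` once
  the fade is short enough (the residual is smooth and vanishes at `τ₀`; not quantified here).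

Finite energy of the germ (its `∇π` tail is square integrable) is the companion file
`PalasekTowerMatchedGermEnergy.lean`.

What is NOT here (design-specific, for the host file of a NAMED `U`): the level-`0` readouts of `U`
(speed floor/ceiling, strain floor, core loop), and above all the GLOBAL ANCHOR
`‖germ t‖ < c₁ Y₀` for `t < τ₀`, which at first order demands `⟪U, V⟫ ≥ 0` at the speed maximum of
`U` — a genuine constraint on the profile (STATUS K-NOTE 2026-08-26 ≈10:01Z: viscous-dominated or
pure-swirl profiles fail it; the Host series avoids it by being quasi-static with `α'(τ₀) = 0` and NO
matching).

References: A. J. Majda, A. L. Bertozzi, *Vorticity and Incompressible Flow* (CUP 2002), §1.8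
Prop. 1.16 (Hodge decomposition, the projection `𝒫`) [cite: MajdaBertozziCUP2002, §1.8 Prop. 1.16];
C. L. Fefferman, Clay problem description, (1)–(2) [cite: FeffermanClay2006, (1) (2)];
S. Palasek, arXiv:2605.13827 §3.3 (the host push) [cite: Palasek2026ElementaryModel, §3.3].
-/

noncomputable section

namespace Summit.NavierStokesRegularity.FluidComputer.PalasekTowerClayBridge.Germ

open Set Function Filter Topology InnerProductSpace
open scoped Topology ContDiff Laplacian RealInnerProductSpace

open Literature.Analysis.FluidPDE

variable (ν : ℝ) (U : EuclideanSpace ℝ (Fin 3) → EuclideanSpace ℝ (Fin 3)) (α β : ℝ → ℝ)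

/-! ## §1 Definitions -/

/-- The DRIFT of the profile `U` at viscosity `ν`: `W := νΔU − (U·∇)U` (the unprojected NS
acceleration of `U`; compactly supported with `U`). [cite: FeffermanClay2006, (1)] -/
def drift : EuclideanSpace ℝ (Fin 3) → EuclideanSpace ℝ (Fin 3) :=
  fun x => ν • (Δ U) x - convect U U x

/-- The PRESSURE POTENTIAL of the germ: `π := Δ⁻¹ div W` (the tree's `divPotential` of the drift;
harmonic off `tsupport U`, dipole decay). [cite: MajdaBertozziCUP2002, §1.8 Prop. 1.16] -/
def pot : EuclideanSpace ℝ (Fin 3) → ℝ :=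
  divPotential (drift ν U)

/-- The NS ACCELERATION of the profile: `V := P W = W − ∇π` (the tree's `classicalLerayProj` of the
drift; divergence free; `= ∂ₜu` of the true NS flow through `U` when `div U = 0`).
[cite: MajdaBertozziCUP2002, §1.8 Prop. 1.16] -/
def accel : EuclideanSpace ℝ (Fin 3) → EuclideanSpace ℝ (Fin 3) :=
  classicalLerayProj (drift ν U)

/-- **The matched germ**: `germ t = α(t) • U + β(t) • V`. [folklore] -/
def germ (t : ℝ) (x : EuclideanSpace ℝ (Fin 3)) : EuclideanSpace ℝ (Fin 3) :=
  α t • U x + β t • accel ν U x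

/-- **The germ's pressure**: `germPres t = β'(t) π − β(t)² |∇π|²/2`. [folklore] -/
def germPres (t : ℝ) (x : EuclideanSpace ℝ (Fin 3)) : ℝ :=
  deriv β t * pot ν U x - β t ^ 2 * (2⁻¹ * ‖gradient (pot ν U) x‖ ^ 2)

/-- **The germ's NS residual** `∂ₜ germ + (germ·∇)germ − νΔ germ + ∇ germPres`, with the time
derivative written out (`∂ₜ germ = α' • U + β' • V`, `hasDerivAt_germ`). By construction
`(germ, germPres)` solves forced NS with THIS force (`isClassicalNSSolutionOn_germ`); the content of
the file is where it vanishes. [cite: FeffermanClay2006, (1)] -/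
def germResid (t : ℝ) (x : EuclideanSpace ℝ (Fin 3)) : EuclideanSpace ℝ (Fin 3) :=
  deriv α t • U x + deriv β t • accel ν U x + convect (germ ν U α β t) (germ ν U α β t) x -
    ν • (Δ (germ ν U α β t)) x + gradient (germPres ν U β t) x

variable {ν U α β}

/-! ## §2 Smoothness and support of the ingredients -/

section Smooth

variable (hU : ContDiff ℝ ∞ U)
include hU

/-- `(U·∇)U` is smooth. [folklore] -/
theorem contDiff_convect_self : ContDiff ℝ ∞ (convect U U) := by
  have h1 : ContDiff ℝ ∞ (fderiv ℝ U) := (contDiff_infty_iff_fderiv.1 hU).2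
  exact (show ContDiff ℝ ∞ (fun x => fderiv ℝ U x (U x)) from h1.clm_apply hU)

/-- The drift is smooth. [folklore] -/
theorem contDiff_drift (ν : ℝ) : ContDiff ℝ ∞ (drift ν U) := by
  have hΔ : ContDiff ℝ ∞ fun y => (Δ U) y :=
    contDiff_infty.2 fun n => contDiff_laplacian (n := n) (contDiff_infty.1 hU (n + 2))
  exact (hΔ.const_smul ν).sub (contDiff_convect_self hU)

omit hU in
/-- Off `tsupport U` the drift vanishes. [folklore] -/
theorem drift_eq_zero_of_notMem_tsupport (ν : ℝ) {x : EuclideanSpace ℝ (Fin 3)}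
    (hx : x ∉ tsupport U) : drift ν U x = 0 := by
  have hUx : U x = 0 := image_eq_zero_of_notMem_tsupport hx
  rw [drift, laplacian_eq_zero_of_notMem_tsupport hx, convect_apply, hUx, map_zero, smul_zero,
    sub_zero]

variable (hUc : HasCompactSupport U)
include hUc

omit hU in
/-- The drift is compactly supported (inside `tsupport U`). [folklore] -/
theorem hasCompactSupport_drift (ν : ℝ) : HasCompactSupport (drift ν U) :=
  hUc.mono' fun x hx => by
    by_contra h
    exact hx (drift_eq_zero_of_notMem_tsupport ν h)

/-- The pressure potential is smooth. [cite: GilbargTrudinger2001, Lemma 4.1] -/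
theorem contDiff_pot (ν : ℝ) : ContDiff ℝ ∞ (pot ν U) :=
  contDiff_divPotential (contDiff_drift hU ν) (hasCompactSupport_drift hUc ν)

/-- The NS acceleration `V` is smooth. [cite: MajdaBertozziCUP2002, §1.8 Prop. 1.16] -/
theorem contDiff_accel (ν : ℝ) : ContDiff ℝ ∞ (accel ν U) :=
  contDiff_classicalLerayProj (contDiff_drift hU ν) (hasCompactSupport_drift hUc ν)

/-- The NS acceleration `V` is divergence free. [cite: MajdaBertozziCUP2002, §1.8 Prop. 1.16] -/
theorem isDivFree_accel (ν : ℝ) : VectorCalculus.IsDivFree (accel ν U) :=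
  isDivFree_classicalLerayProj (contDiff_drift hU ν) (hasCompactSupport_drift hUc ν)

/-- **Poisson**: `Δπ = div W`. [cite: GilbargTrudinger2001, Lemma 4.2] -/
theorem laplacian_pot (ν : ℝ) (x : EuclideanSpace ℝ (Fin 3)) :
    (Δ (pot ν U)) x = VectorCalculus.divergence (drift ν U) x :=
  laplacian_divPotential (contDiff_drift hU ν) (hasCompactSupport_drift hUc ν) x

omit hU hUc in
/-- Helmholtz: `V = W − ∇π` pointwise. [cite: MajdaBertozziCUP2002, §1.8 Prop. 1.16 (1.91)] -/
theorem accel_apply (ν : ℝ) (x : EuclideanSpace ℝ (Fin 3)) :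
    accel ν U x = drift ν U x - gradient (pot ν U) x :=
  classicalLerayProj_apply _ x

/-! ## §3 Off the profile's support: a potential flow with harmonic potential -/

/-- **`π` is harmonic off `tsupport U`** (there `Δπ = div W = 0`, locally). [folklore] -/
theorem laplacian_pot_eventuallyEq_zero (ν : ℝ) {x : EuclideanSpace ℝ (Fin 3)}
    (hx : x ∉ tsupport U) : Δ (pot ν U) =ᶠ[𝓝 x] fun _ => (0 : ℝ) := by
  have hopen : IsOpen (tsupport U)ᶜ := (isClosed_tsupport U).isOpen_compl
  filter_upwards [hopen.mem_nhds hx] with y hy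
  rw [laplacian_pot hU hUc ν y]
  have hW : drift ν U =ᶠ[𝓝 y] fun _ => 0 := by
    filter_upwards [hopen.mem_nhds hy] with z hz
    exact drift_eq_zero_of_notMem_tsupport ν hz
  unfold VectorCalculus.divergence
  rw [hW.fderiv_eq, fderiv_fun_const]
  simp

omit hU hUc in
/-- **Off `tsupport U` the acceleration IS the potential flow `−∇π`, locally.** [folklore] -/
theorem accel_eventuallyEq_neg_gradient (ν : ℝ) {x : EuclideanSpace ℝ (Fin 3)}
    (hx : x ∉ tsupport U) : accel ν U =ᶠ[𝓝 x] fun y => -gradient (pot ν U) y := by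
  have hopen : IsOpen (tsupport U)ᶜ := (isClosed_tsupport U).isOpen_compl
  filter_upwards [hopen.mem_nhds hx] with y hy
  rw [accel_apply ν y, drift_eq_zero_of_notMem_tsupport ν hy, zero_sub]

/-- Off `tsupport U`: `Δ V = 0` (the gradient of a harmonic function is harmonic). [folklore] -/
theorem laplacian_accel_eq_zero (ν : ℝ) {x : EuclideanSpace ℝ (Fin 3)} (hx : x ∉ tsupport U) :
    (Δ (accel ν U)) x = 0 := by
  rw [(laplacian_congr_nhds (accel_eventuallyEq_neg_gradient ν hx)).eq_of_nhds]
  have h3 : ContDiff ℝ 3 (pot ν U) := (contDiff_pot hU hUc ν).of_le (by norm_cast)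
  have hg : Δ (gradient (pot ν U)) x = 0 :=
    laplacian_gradient_eq_zero h3 (laplacian_pot_eventuallyEq_zero hU hUc ν hx)
  have hneg : (fun y => -gradient (pot ν U) y) = -(gradient (pot ν U)) := rfl
  rw [hneg, InnerProductSpace.laplacian_neg, Pi.neg_apply, hg, neg_zero]

/-- Off `tsupport U`: `(V·∇)V = ∇(|∇π|²/2)` (Bernoulli for the potential flow `−∇π`). [folklore] -/
theorem convect_accel_eq (ν : ℝ) {x : EuclideanSpace ℝ (Fin 3)} (hx : x ∉ tsupport U) :
    convect (accel ν U) (accel ν U) x =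
      gradient (fun y => 2⁻¹ * ‖gradient (pot ν U) y‖ ^ 2) x := by
  have h2 : ContDiff ℝ 2 (pot ν U) := (contDiff_pot hU hUc ν).of_le (by norm_cast)
  have hloc := accel_eventuallyEq_neg_gradient ν hx
  rw [convect_apply, hloc.fderiv_eq, hloc.eq_of_nhds]
  have hneg : (fun y => -gradient (pot ν U) y) = -(gradient (pot ν U)) := rfl
  rw [hneg, fderiv_neg, _root_.neg_apply, map_neg, neg_neg, ← convect_apply]
  exact convect_gradient_self h2 x

end Smooth

/-! ## §4 The germ: time derivative, smoothness, incompressibility, the exact forced system -/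

section Germ

variable (hU : ContDiff ℝ ∞ U) (hUc : HasCompactSupport U)
  (hα : ContDiff ℝ ∞ α) (hβ : ContDiff ℝ ∞ β)

/-- The time lines of the germ are differentiable with derivative `α' • U + β' • V`. [folklore] -/
theorem hasDerivAt_germ (hαd : Differentiable ℝ α) (hβd : Differentiable ℝ β) (t : ℝ)
    (x : EuclideanSpace ℝ (Fin 3)) :
    HasDerivAt (fun s => germ ν U α β s x) (deriv α t • U x + deriv β t • accel ν U x) t :=
  ((hαd t).hasDerivAt.smul_const (U x)).add ((hβd t).hasDerivAt.smul_const (accel ν U x))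

/-- **The one-sided time derivative of the germ within a slab `[0, T]`** (`T > 0`). [folklore] -/
theorem timeDerivWithin_germ (hαd : Differentiable ℝ α) (hβd : Differentiable ℝ β) {T : ℝ}
    (hT : 0 < T) {t : ℝ} (ht : t ∈ Icc 0 T) (x : EuclideanSpace ℝ (Fin 3)) :
    timeDerivWithin (Icc 0 T) (germ ν U α β) t x = deriv α t • U x + deriv β t • accel ν U x := by
  rw [timeDerivWithin_apply]
  exact (hasDerivAt_germ hαd hβd t x).hasDerivWithinAt.derivWithin (uniqueDiffOn_Icc hT t ht)

include hU hUc

/-- The germ's time slices are smooth. [folklore] -/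
theorem contDiff_germ (t : ℝ) : ContDiff ℝ ∞ (germ ν U α β t) :=
  (hU.const_smul (α t)).add ((contDiff_accel hU hUc ν).const_smul (β t))

/-- The germ's time slices are divergence free when the profile is. [folklore] -/
theorem isDivFree_germ (hdiv : VectorCalculus.IsDivFree U) (t : ℝ) :
    VectorCalculus.IsDivFree (germ ν U α β t) := fun x => by
  have h1 : VectorCalculus.divergence U x = 0 := hdiv x
  have h2 : VectorCalculus.divergence (accel ν U) x = 0 := isDivFree_accel hU hUc ν x
  have hdU : DifferentiableAt ℝ U x := (hU.differentiable (by simp)) x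
  have hdV : DifferentiableAt ℝ (accel ν U) x :=
    ((contDiff_accel hU hUc ν).differentiable (by simp)) x
  have hdU' : DifferentiableAt ℝ (fun y => α t • U y) x := hdU.const_smul (α t)
  have hdV' : DifferentiableAt ℝ (fun y => β t • accel ν U y) x := hdV.const_smul (β t)
  have hD : fderiv ℝ (germ ν U α β t) x = α t • fderiv ℝ U x + β t • fderiv ℝ (accel ν U) x := by
    show fderiv ℝ (fun y => α t • U y + β t • accel ν U y) x = _
    rw [fderiv_fun_add hdU' hdV', fderiv_fun_const_smul hdU, fderiv_fun_const_smul hdV]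
  unfold VectorCalculus.divergence at h1 h2 ⊢
  rw [hD]
  push_cast
  rw [map_add, map_smul, map_smul, h1, h2, smul_zero, smul_zero, add_zero]

include hα hβ

/-- The germ is jointly smooth in `(t, x)`. [folklore] -/
theorem contDiff_uncurry_germ : ContDiff ℝ ∞ (uncurry (germ ν U α β)) := by
  have hV := contDiff_accel hU hUc ν
  exact ((hα.comp contDiff_fst).smul (hU.comp contDiff_snd)).add
    ((hβ.comp contDiff_fst).smul (hV.comp contDiff_snd))

omit hα in
/-- The germ's pressure is jointly smooth in `(t, x)`. [folklore] -/
theorem contDiff_uncurry_germPres : ContDiff ℝ ∞ (uncurry (germPres ν U β)) := by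
  have hπ := contDiff_pot hU hUc ν
  have hβ' : ContDiff ℝ ∞ (deriv β) := (contDiff_infty_iff_deriv.1 hβ).2
  have hgrad : ContDiff ℝ ∞ (gradient (pot ν U)) := contDiff_gradient_of_contDiff_top hπ
  have hn : ContDiff ℝ ∞ fun y : EuclideanSpace ℝ (Fin 3) => 2⁻¹ * ‖gradient (pot ν U) y‖ ^ 2 :=
    contDiff_const.mul (hgrad.norm_sq ℝ)
  exact ((hβ'.comp contDiff_fst).mul (hπ.comp contDiff_snd)).sub
    (((hβ.comp contDiff_fst).pow 2).mul (hn.comp contDiff_snd))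

/-- **By construction `(germ, germPres)` is an exact classical solution of forced Navier–Stokes on
every slab `[0, T]`, `T > 0`, with force `germResid`** (when `div U = 0`). [cite: FeffermanClay2006, (1) (2)] -/
theorem isClassicalNSSolutionOn_germ (hdiv : VectorCalculus.IsDivFree U) {T : ℝ} (hT : 0 < T) :
    IsClassicalNSSolutionOn (Icc 0 T) ν (germResid ν U α β) (germ ν U α β) (germPres ν U β) where
  smooth_velocity := (contDiff_uncurry_germ hU hUc hα hβ).contDiffOn
  smooth_pressure := (contDiff_uncurry_germPres hU hUc hβ).contDiffOn
  momentum t ht x := by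
    rw [timeDerivWithin_germ (hα.differentiable (by simp)) (hβ.differentiable (by simp)) hT ht x,
      germResid]
    abel
  divFree t _ := isDivFree_germ hU hUc hdiv t

end Germ

/-! ## §5 Where the residual vanishes -/

section Residual

variable (hU : ContDiff ℝ ∞ U) (hUc : HasCompactSupport U)
include hU hUc

/-- The gradient of the germ's pressure: `∇ germPres t = β' ∇π − β² ∇(|∇π|²/2)`. [folklore] -/
theorem gradient_germPres (t : ℝ) (x : EuclideanSpace ℝ (Fin 3)) :
    gradient (germPres ν U β t) x =
      deriv β t • gradient (pot ν U) x -
        β t ^ 2 • gradient (fun y => 2⁻¹ * ‖gradient (pot ν U) y‖ ^ 2) x := by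
  have hπ := contDiff_pot hU hUc ν
  have hπd : DifferentiableAt ℝ (pot ν U) x := (hπ.differentiable (by simp)) x
  have hgrad : ContDiff ℝ ∞ (gradient (pot ν U)) := contDiff_gradient_of_contDiff_top hπ
  have hn : DifferentiableAt ℝ (fun y : EuclideanSpace ℝ (Fin 3) => 2⁻¹ * ‖gradient (pot ν U) y‖ ^ 2) x :=
    ((contDiff_const.mul (hgrad.norm_sq ℝ)).differentiable (by simp)) x
  set L := InnerProductSpace.toDual ℝ (EuclideanSpace ℝ (Fin 3)) with hL
  have h1 : HasFDerivAt (fun y => deriv β t * pot ν U y) (L (deriv β t • gradient (pot ν U) x)) x := by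
    have h := hasGradientAt_iff_hasFDerivAt.1 hπd.hasGradientAt
    refine (h.const_mul (deriv β t)).congr_fderiv ?_
    rw [map_smul]
  have h2 : HasFDerivAt (fun y => β t ^ 2 * (2⁻¹ * ‖gradient (pot ν U) y‖ ^ 2))
      (L (β t ^ 2 • gradient (fun y => 2⁻¹ * ‖gradient (pot ν U) y‖ ^ 2) x)) x := by
    have h := hasGradientAt_iff_hasFDerivAt.1 hn.hasGradientAt
    refine (h.const_mul (β t ^ 2)).congr_fderiv ?_
    rw [map_smul]
  have h12 : HasFDerivAt (germPres ν U β t)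
      (L (deriv β t • gradient (pot ν U) x -
        β t ^ 2 • gradient (fun y => 2⁻¹ * ‖gradient (pot ν U) y‖ ^ 2) x)) x := by
    rw [map_sub]
    exact h1.sub h2
  exact (hasGradientAt_iff_hasFDerivAt.2 h12).gradient

/-- **THE FORCE IS CONFINED TO THE PROFILE'S SUPPORT**: off `tsupport U` the residual of the germ
vanishes identically, at every time (there `germ = −β ∇π`, `π` harmonic: `∂ₜ germ = −β'∇π`,
`(germ·∇)germ = β²∇(|∇π|²/2)`, `Δ germ = 0`, `∇ germPres = β'∇π − β²∇(|∇π|²/2)`). [folklore] -/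
theorem germResid_eq_zero_of_notMem_tsupport (t : ℝ) {x : EuclideanSpace ℝ (Fin 3)}
    (hx : x ∉ tsupport U) : germResid ν U α β t x = 0 := by
  have hopen : IsOpen (tsupport U)ᶜ := (isClosed_tsupport U).isOpen_compl
  have hUx : U x = 0 := image_eq_zero_of_notMem_tsupport hx
  have hU0 : U =ᶠ[𝓝 x] fun _ => 0 := by
    filter_upwards [hopen.mem_nhds hx] with y hy using image_eq_zero_of_notMem_tsupport hy
  -- the germ near `x` is `β t • V`
  have hgerm : germ ν U α β t =ᶠ[𝓝 x] fun y => β t • accel ν U y := by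
    filter_upwards [hU0] with y hy
    rw [germ, hy, smul_zero, zero_add]
  have hV2 : ContDiff ℝ 2 (accel ν U) := (contDiff_accel hU hUc ν).of_le (by norm_cast)
  have hdV : DifferentiableAt ℝ (accel ν U) x := (hV2.differentiable (by norm_num)) x
  -- convective term
  have hconv : convect (germ ν U α β t) (germ ν U α β t) x =
      β t ^ 2 • gradient (fun y => 2⁻¹ * ‖gradient (pot ν U) y‖ ^ 2) x := by
    rw [convect_apply, hgerm.fderiv_eq, hgerm.eq_of_nhds, fderiv_fun_const_smul hdV,
      _root_.smul_apply, map_smul, smul_smul, ← convect_apply, convect_accel_eq hU hUc ν hx, sq]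
  -- Laplacian term
  have hlap : (Δ (germ ν U α β t)) x = 0 := by
    rw [(laplacian_congr_nhds hgerm).eq_of_nhds]
    have e : (fun y => β t • accel ν U y) = β t • accel ν U := rfl
    rw [e, InnerProductSpace.laplacian_smul _ hV2.contDiffAt, laplacian_accel_eq_zero hU hUc ν hx,
      smul_zero]
  -- the acceleration at `x` is `−∇π x`
  have hVx : accel ν U x = -gradient (pot ν U) x :=
    (accel_eventuallyEq_neg_gradient ν hx).eq_of_nhds
  rw [germResid, hconv, hlap, gradient_germPres hU hUc t x, hUx, hVx]
  module

omit hU hUc in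
/-- **THE RESIDUAL VANISHES AT THE MATCHED INSTANT**: if `α(τ₀) = 1`, `α'(τ₀) = 0`, `β(τ₀) = 0`,
`β'(τ₀) = 1` then `germResid τ₀ ≡ 0` — the germ passes through `U` at `τ₀` with velocity `V` and
pressure `π`, and `V + (U·∇)U − νΔU + ∇π = 0` is the Helmholtz decomposition of the drift.
[cite: MajdaBertozziCUP2002, §1.8 Prop. 1.16 (1.91)] -/
theorem germResid_eq_zero_of_matched {τ₀ : ℝ} (hα0 : α τ₀ = 1) (hα1 : deriv α τ₀ = 0)
    (hβ0 : β τ₀ = 0) (hβ1 : deriv β τ₀ = 1) (x : EuclideanSpace ℝ (Fin 3)) :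
    germResid ν U α β τ₀ x = 0 := by
  have hgerm : germ ν U α β τ₀ = U := by
    funext y; rw [germ, hα0, hβ0, one_smul, zero_smul, add_zero]
  have hpres : germPres ν U β τ₀ = pot ν U := by
    funext y; rw [germPres, hβ1, hβ0]; ring
  rw [germResid, hgerm, hpres, hα1, hβ1, zero_smul, one_smul, zero_add, accel_apply ν x,
    drift]
  abel

/-- **Confinement to a ball**: if `tsupport U ⊆ B̄(0, R)` then the residual vanishes outside that
ball at every time (the schedule's `force_confined`). [folklore] -/
theorem germResid_eq_zero_of_norm_gt {R : ℝ} (hR : tsupport U ⊆ Metric.closedBall 0 R) (t : ℝ)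
    {x : EuclideanSpace ℝ (Fin 3)} (hx : R < ‖x‖) : germResid ν U α β t x = 0 :=
  germResid_eq_zero_of_notMem_tsupport hU hUc t fun h => by
    have := hR h
    rw [Metric.mem_closedBall, dist_zero_right] at this
    exact absurd this (not_le.2 hx)

omit hU hUc in
/-- The germ starts from rest if `α(0) = β(0) = 0` (Clay datum `0`). [folklore] -/
theorem germ_zero (hα : α 0 = 0) (hβ : β 0 = 0) : germ ν U α β 0 = 0 := by
  funext x
  rw [germ, hα, hβ, zero_smul, zero_smul, add_zero]
  rfl

end Residual


end Summit.NavierStokesRegularity.FluidComputer.PalasekTowerClayBridge.Germ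

end
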